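import Literature.AnabelianGeometry.AbsoluteAnabelian.GaloisSectionsFactsThm43Schema
import Mathlib.Topology.Instances.ZMod
import HarnessLib

/-!
# [GalSect] Thm. 4.3 (`GalSect.Thm_4_3`, FACT-LIST F-0105): INSTANCE FORMS at the cyclotome `ℤ/2ℤ`

S. Mochizuki, *Galois sections in absolute anabelian geometry*, Nagoya Math. J. **179** (2005) 17–45
[MochizukiGalSect2005], Thm. 4.3 p. 17 of the kurims manuscript (`paper:url-1b7afe4e6889`; Rigidity of Cuspidal
Geometric Decomposition Groups — "cyclotomic synchronization"): for `α : Π_{X_K} ⥲ Π_{Y_L}` inducing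
`I_x ⥲ I_y` and `μ^∧_{ℚ/ℤ}(K̄) ⥲ μ^∧_{ℚ/ℤ}(L̄)`, "these isomorphisms are compatible with the natural isomorphisms
`μ^∧_{ℚ/ℤ}(K̄) ⥲ I_x`; `μ^∧_{ℚ/ℤ}(L̄) ⥲ I_y`".  Cell abc-iut, block F, seat abc-iut-f-053 (gen 4), KEY row
INST59H3.  PROOF-ONLY companion of `GaloisSectionsFacts.lean` (abc-iut-L4-t16; imported, never edited).

THE ROW.  `GalSect.Thm_4_3 T sx sy` is a PREDICATE on a cyclotome interface `T : GalSect.GaloisCyclotome`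
(`G ↦ μ(G)` with functorial transport along isomorphisms) and two cuspidal synchronizations
`sx : μ(G_K) ⥲ I_x`, `sy : μ(G_L) ⥲ I_y`.  abc-iut-F-lit's kernel census (`plan/LF-KERNEL-STATUS.tsv` col. 14)
holds the closure refuter `GalSect.not_forall_thm_4_3` / `not_thm_4_3_inv_twist` (abc-iut-f-097: twist a
synchronization by inversion) and ONE conditional closer, `thm_4_3_of_subsingleton` (`Π_{Y_L}` trivial — then
`I_y = 1` and every synchronization type is EMPTY unless `μ = 1`), and no instance-type theorem.

WHAT HOLDS, AND WHY ONLY THIS.  The predicate asks that `α|_{I_x}` be READ OFF `α_G` through `T.map`.  For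
abstract data this fails whenever `I_x` has an automorphism not forced by `α_G` (f-097's inversion twist); it
holds outright exactly when the cyclotome admits no nontrivial automorphism, i.e. for `μ ≅ ℤ/2ℤ` (or `μ = 1`):
* `GalSect.thm_4_3_zmodTwoCyclotome` — for the CONSTANT cyclotome `μ(G) := ℤ/2ℤ` (all transports the identity;
  functorial) and ALL extensions `E`, `F`, cusps `x`, `y` and synchronizations `sx`, `sy` (so `I_x`, `I_y` have
  order `2`): `Thm_4_3` holds — `α` maps the non-identity element of `I_x` to the non-identity element of
  `I_y`, which is where `sy` sends the generator.  0 hypotheses; conclusion head = the row.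
* `GalSect.exists_cuspidalSynchronization_zmodTwo` — the binders of the previous theorem are INHABITED: the
  extension `Π = Δ := ℤ/2ℤ ↠ G := 1` (finite discrete), one cusp with `D_x = I_x = Π`, synchronization
  `ℤ/2ℤ ⥲ I_x`; and `GalSect.thm_4_3_zmodTwoCyclotome_nonvacuous` records `Thm_4_3` at an inhabited instance.

HONEST LABEL: DEGENERATE (the one cyclotome without automorphisms; in print `μ ≅ Ẑ(1)`).  The arithmetic
content of Thm. 4.3 — local class field theory pins `α|_{I_x}` to the cyclotomic character of `α_G` — is not
touched and not claimed; at the intended instance the row stays a NAMED INPUT (consumed BY NAME, e.g.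
`TemperedCurve.…_of_thm_4_3`, `TemperedAbsolutenessCyclotomicRigidityGalSectJunction.lean`).  Statements about OUR
typed interface; refuted-as-schema ≠ refuted-in-print; typed ≠ proved; nothing here bears on the disputed
[IUTchIII] Cor. 3.12; no side taken.
-/

noncomputable section

namespace Literature.AnabelianGeometry.AbsoluteAnabelian

namespace GalSect

/-! ### The group `ℤ/2ℤ`: its only non-identity element -/

/-- In `ℤ/2ℤ` an element different from `1` is the generator. [cite: MochizukiGalSect2005, Thm 4.3 p.17] -/
theorem eq_ofAdd_one_of_ne_one {m : Multiplicative (ZMod 2)} (hm : m ≠ 1) :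
    m = Multiplicative.ofAdd (1 : ZMod 2) := by
  revert m
  decide

/-- The generator of `ℤ/2ℤ` is not the identity. [cite: MochizukiGalSect2005, Thm 4.3 p.17] -/
theorem ofAdd_one_ne_one_zmodTwo : Multiplicative.ofAdd (1 : ZMod 2) ≠ 1 := by decide

/-! ### F-0105 for the constant cyclotome `ℤ/2ℤ`, over all data -/

/-- **F-0105, INSTANCE FORM for the constant cyclotome `μ := ℤ/2ℤ`** (all transports `id`; functorial), over ALL
extensions `E`, `F`, cuspidal data, cusps `x`, `y` and synchronizations `sx : ℤ/2 ⥲ I_x`, `sy : ℤ/2 ⥲ I_y`: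
`Thm_4_3` HOLDS — for `α : Π_{X_K} ⥲ Π_{Y_L}` over `α_G` with `α(I_x) = I_y`, the element `α(sx(t))` (`t` the
generator) is a non-identity element of `I_y`, a group of order two, hence equals `sy(t) = sy(T.map α_G t)`.
DEGENERATE (no automorphism of the cyclotome to detect); 0 hypotheses; every binder type is inhabited
(`exists_cuspidalSynchronization_zmodTwo`). [cite: MochizukiGalSect2005, Thm 4.3 p.17] -/
theorem thm_4_3_zmodTwoCyclotome {E F : FundamentalExtension.{0}} {Cx : E.CuspidalData} {Cy : F.CuspidalData}
    {x : Cx.Cusp} {y : Cy.Cusp}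
    (sx : CuspidalSynchronization
      ({ μ := fun _ => Multiplicative (ZMod 2), map := fun _ => MulEquiv.refl _
         map_refl := fun _ => rfl, map_trans := fun _ _ => rfl } : GaloisCyclotome.{0}) E Cx x)
    (sy : CuspidalSynchronization
      ({ μ := fun _ => Multiplicative (ZMod 2), map := fun _ => MulEquiv.refl _
         map_refl := fun _ => rfl, map_trans := fun _ _ => rfl } : GaloisCyclotome.{0}) F Cy y) :
    Literature.AnabelianGeometry.AbsoluteAnabelian.GalSect.Thm_4_3
      ({ μ := fun _ => Multiplicative (ZMod 2), map := fun _ => MulEquiv.refl _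
         map_refl := fun _ => rfl, map_trans := fun _ _ => rfl } : GaloisCyclotome.{0}) sx sy := by
  intro α αG _ hI m
  -- `T.map αG = id`
  change α ((sx.natIso m : Cx.Icusp x) : E.arith) = ((sy.natIso m : Cy.Icusp y) : F.arith)
  by_cases hm : m = 1
  · subst hm
    rw [map_one, map_one, Subgroup.coe_one, Subgroup.coe_one, map_one]
  · -- `α (sx m)` lies in `I_y = α(I_x)` and is not the identity
    have hmem : α ((sx.natIso m : Cx.Icusp x) : E.arith) ∈ Cy.Icusp y := by
      rw [← hI]
      exact ⟨_, (sx.natIso m).2, rfl⟩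
    have hne : α ((sx.natIso m : Cx.Icusp x) : E.arith) ≠ 1 := by
      intro h
      have h1 : ((sx.natIso m : Cx.Icusp x) : E.arith) = 1 :=
        α.injective (h.trans (map_one α).symm)
      have h2 : sx.natIso m = 1 := Subtype.ext h1
      exact hm (sx.natIso.injective (h2.trans (map_one sx.natIso).symm))
    -- pull back along `sy`: a non-identity element of `ℤ/2` is the generator, as is `m`
    obtain ⟨u, hu'⟩ : ∃ u : Multiplicative (ZMod 2), sy.natIso u = ⟨_, hmem⟩ :=
      ⟨_, sy.natIso.apply_symm_apply _⟩
    have hune : u ≠ 1 := by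
      intro h
      apply hne
      have h' : ((sy.natIso u : Cy.Icusp y) : F.arith) = α ((sx.natIso m : Cx.Icusp x) : E.arith) :=
        congrArg (fun z : Cy.Icusp y => (z : F.arith)) hu'
      rw [← h', h, map_one, Subgroup.coe_one]
    have hum : u = m := (eq_ofAdd_one_of_ne_one hune).trans (eq_ofAdd_one_of_ne_one hm).symm
    have hcoe : ((sy.natIso u : Cy.Icusp y) : F.arith) = ((sy.natIso m : Cy.Icusp y) : F.arith) :=
      congrArg (fun v => ((sy.natIso v : Cy.Icusp y) : F.arith)) hum
    symm
    rw [← hcoe, hu']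

/-! ### The binders are inhabited: a synchronization at `Π = ℤ/2ℤ ↠ 1` -/

/-- **Non-vacuity of `thm_4_3_zmodTwoCyclotome`**: there are an extension (`Π = Δ := ℤ/2ℤ ↠ G := 1`, finite
discrete), a cuspidal datum (one cusp, `D_x = I_x = Π`, closed) and a synchronization `ℤ/2ℤ ⥲ I_x` for the
constant cyclotome `ℤ/2ℤ`.  TOY data. [cite: MochizukiGalSect2005, Thm 4.3 p.17] -/
theorem exists_cuspidalSynchronization_zmodTwo :
    ∃ (E : FundamentalExtension.{0}) (C : E.CuspidalData) (x : C.Cusp),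
      Nonempty (CuspidalSynchronization
        ({ μ := fun _ => Multiplicative (ZMod 2), map := fun _ => MulEquiv.refl _
           map_refl := fun _ => rfl, map_trans := fun _ _ => rfl } : GaloisCyclotome.{0}) E C x) := by
  let P : ProfiniteGrp.{0} := ProfiniteGrp.of (Multiplicative (ZMod 2))
  let G : ProfiniteGrp.{0} := ProfiniteGrp.of PUnit.{1}
  let E : FundamentalExtension.{0} :=
    { arith := P, gal := G, aug := 1, aug_surjective := fun u => ⟨1, Subsingleton.elim _ _⟩ }
  have hgeom : E.geom = ⊤ :=
    eq_top_iff.mpr fun g _ => E.mem_geom.mpr (Subsingleton.elim _ _)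
  let C : E.CuspidalData :=
    { Cusp := PUnit
      Dcusp := fun _ => ⊤
      Icusp := fun _ => ⊤
      Icusp_eq := fun _ => by rw [top_inf_eq, hgeom]
      isClosed_Dcusp := fun _ => by
        rw [Subgroup.coe_top]
        exact isClosed_univ
      eq_of_conj := fun _ _ _ _ => rfl }
  exact ⟨E, C, PUnit.unit, ⟨⟨(Subgroup.topEquiv : (⊤ : Subgroup E.arith) ≃* E.arith).symm⟩⟩⟩

/-- **F-0105 at an inhabited instance**: `Thm_4_3` for the constant cyclotome `ℤ/2ℤ` holds at SOME data (by
`thm_4_3_zmodTwoCyclotome` at the witness of `exists_cuspidalSynchronization_zmodTwo`, with `Y_L := X_K`,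
`y := x`, `sy := sx`).  Recorded so that the instance form is visibly non-vacuous.
[cite: MochizukiGalSect2005, Thm 4.3 p.17] -/
theorem thm_4_3_zmodTwoCyclotome_nonvacuous :
    ∃ (E : FundamentalExtension.{0}) (C : E.CuspidalData) (x : C.Cusp)
      (sx : CuspidalSynchronization
        ({ μ := fun _ => Multiplicative (ZMod 2), map := fun _ => MulEquiv.refl _
           map_refl := fun _ => rfl, map_trans := fun _ _ => rfl } : GaloisCyclotome.{0}) E C x),
      Literature.AnabelianGeometry.AbsoluteAnabelian.GalSect.Thm_4_3
        ({ μ := fun _ => Multiplicative (ZMod 2), map := fun _ => MulEquiv.refl _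
           map_refl := fun _ => rfl, map_trans := fun _ _ => rfl } : GaloisCyclotome.{0}) sx sx := by
  obtain ⟨E, C, x, ⟨sx⟩⟩ := exists_cuspidalSynchronization_zmodTwo
  exact ⟨E, C, x, sx, thm_4_3_zmodTwoCyclotome sx sx⟩

end GalSect

end Literature.AnabelianGeometry.AbsoluteAnabelian

end
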